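import Summits.SmoothPoincare4.SmoothPoincare4.Theses.InformationMetricHadamard
import Summits.SmoothPoincare4.SmoothPoincare4.Theorems.InformationMetricHadamardC0AhRecognitionStubFarCollarIsFar

/-!
# Stub `stub_nearestPointSpread` of line `core-distance-morse` — auxiliary file 3: first exit and lift
(crux `InformationMetricHadamard.C0AhRecognition`, stmt-SmoothPoincare4-6015)

`helper_nearestPointSpread_footLift` (registered helper). Let the end collar `Ψ : N × (0,1) → W⁵`
(`N` compact) be smooth and injective with the closure clause, immersive on `N × (0,t₀)` and with
metrically far deep points (`hfar`, the landed `Sketch.stub_farCollarIsFar`). Fix a level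
`s < t₀`, a deep point `y = Ψ(x₀, λ₀)`, `λ₀ < s`, and a nearest point `k` of `y` on the far core
`K_s = (Ψ(N × (0,s)))ᶜ` at finite distance `T`. Then for every `δ > 0` there is a **foot**
`x ∈ N` with `d_G(k, Ψ(x,s)) ≤ δ`, together with a `C¹` lift `β : [0,τ] → N × (0,s]` (through the
local inverse of `Ψ`, `Sketch.collar_localInverse`) of the initial segment of a near-minimising
path from `y` to `k`: `β(0) = (x₀, λ₀)`, `β(τ) = (x, s)`, and `G`-length of `Ψ ∘ β` at most
`T + δ`. Mechanism: a `C¹` path from `y` to `k` of length `< T + δ` first meets the closed set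
`K_s` at a time `τ > 0` (the far part is open, `Sketch.collar_localInverse`), at a point of
`cl Ψ(N × (0,s)) ∖ Ψ(N × (0,s)) = Ψ(N × {s})` (closure clause, compactness of `N × [t',s]` and
`hfar` to exclude limits of ever deeper points — the argument of stub P's `closure_image_far'`), after
`G`-length `≥ T` (it is a nearest point), so the remaining piece to `k` is shorter than `δ`.
Everything is proved (kind = proof); no definitions.
-/

noncomputable section

-- the prescribed namespace `Summit.<P>.<Sub>.…` duplicates `SmoothPoincare4` (P = Sub)
set_option linter.dupNamespace false

open scoped Manifold ContDiff Topology ENNReal NNReal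
open Set Function Bundle

namespace Summit.SmoothPoincare4.SmoothPoincare4.Cruxes.C0AhRecognition.CoreDistanceMorse

open Literature.Geometry.Lorentzian (PseudoRiemannianMetric)

/-- **First exit and lift of a near-minimiser (one foot).** See the module docstring: for a
nearest point `k` of the deep point `Ψ(x₀, λ₀)` on the far core `K_s` at finite distance `T` and
`δ > 0`, there are a foot `x` with `d_G(k, Ψ(x,s)) ≤ δ` and a `C¹` path `β` on an open `U ⊇ [0,τ]`
with heights in `(0,s]` on `[0,τ]`, `β 0 = (x₀,λ₀)`, `β τ = (x,s)` and
`L_G(Ψ ∘ β|[0,τ]) ≤ T + δ`. [folklore] -/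
theorem helper_nearestPointSpread_footLift
    (N : Type) [TopologicalSpace N] [CompactSpace N] [Nonempty N]
    [ChartedSpace (EuclideanSpace ℝ (Fin 4)) N] [IsManifold (𝓡 4) ∞ N]
    (W : Type) [TopologicalSpace W] [T2Space W] [RegularSpace W]
    [ChartedSpace (EuclideanSpace ℝ (Fin 5)) W] [IsManifold (𝓡 5) ∞ W]
    (G : PseudoRiemannianMetric (𝓡 5) ∞ (EuclideanSpace ℝ (Fin 5)) (TangentSpace (𝓡 5) : W → Type _))
    (hG : G.IsRiemannian) (Ψ : N × ℝ → W)
    (hsm : ContMDiffOn ((𝓡 4).prod 𝓘(ℝ, ℝ)) (𝓡 5) ∞ Ψ (univ ×ˢ Ioo (0 : ℝ) 1))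
    (hinj : InjOn Ψ (univ ×ˢ Ioo (0 : ℝ) 1))
    (hcl : ∀ t ∈ Ioo (0 : ℝ) 1, closure (Ψ '' (univ ×ˢ Ioo (0 : ℝ) t)) ⊆ Ψ '' (univ ×ˢ Ioo (0 : ℝ) 1))
    (t₀ : ℝ) (ht₀ : t₀ ∈ Ioo (0 : ℝ) 1)
    (himm : ∀ (y : N) (l : ℝ), l ∈ Ioo (0 : ℝ) t₀ →
      Injective (mfderiv ((𝓡 4).prod 𝓘(ℝ, ℝ)) (𝓡 5) Ψ (y, l)))
    (hfar : ∀ (x₀ : W) (R : NNReal), ∃ t ∈ Ioo (0 : ℝ) 1, ∀ (y : N) (l : ℝ), l ∈ Ioo (0 : ℝ) t →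
      (R : ℝ≥0∞) < G.edist hG x₀ (Ψ (y, l)))
    (s : ℝ) (hs : s ∈ Ioo (0 : ℝ) t₀) (x₀ : N) (lam0 : ℝ) (hlam0 : lam0 ∈ Ioo (0 : ℝ) s)
    (k : W) (hk : k ∈ (Ψ '' (univ ×ˢ Ioo (0 : ℝ) s))ᶜ)
    (hmin : ∀ k' ∈ (Ψ '' (univ ×ˢ Ioo (0 : ℝ) s))ᶜ,
      G.edist hG (Ψ (x₀, lam0)) k ≤ G.edist hG (Ψ (x₀, lam0)) k')
    (hfin : G.edist hG (Ψ (x₀, lam0)) k ≠ ⊤) (δ : ℝ) (hδ : 0 < δ) :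
    ∃ (x : N) (β : ℝ → N × ℝ) (U : Set ℝ) (τ : ℝ),
      G.edist hG k (Ψ (x, s)) ≤ ENNReal.ofReal δ ∧ IsOpen U ∧ 0 ≤ τ ∧ Icc 0 τ ⊆ U ∧
      ContMDiffOn 𝓘(ℝ, ℝ) ((𝓡 4).prod 𝓘(ℝ, ℝ)) 1 β U ∧
      (∀ ρ ∈ Icc 0 τ, (β ρ).2 ∈ Ioc (0 : ℝ) s) ∧ β 0 = (x₀, lam0) ∧ β τ = (x, s) ∧
      G.length hG (Ψ ∘ β) 0 τ ≤ ENNReal.ofReal ((G.edist hG (Ψ (x₀, lam0)) k).toReal + δ) := by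
  have hs1 : s ∈ Ioo (0 : ℝ) 1 := ⟨hs.1, hs.2.trans ht₀.2⟩
  -- the far part `U = Ψ(N × (0,s))` is open with closure `Ψ(N × (0,s])`
  set U : Set W := Ψ '' (univ ×ˢ Ioo (0 : ℝ) s) with hU
  have hUo : IsOpen U := by
    rw [isOpen_iff_mem_nhds]
    rintro _ ⟨p, hp, rfl⟩
    exact (Sketch.collar_localInverse Ψ hs.2.le ht₀.2 hsm hinj himm hp).1
  have hyU : Ψ (x₀, lam0) ∈ U := ⟨(x₀, lam0), ⟨mem_univ _, hlam0⟩, rfl⟩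
  -- a near-minimising `C¹` path from `y` to `k`
  letI := G.riemannianBundle hG
  have hlt : Manifold.riemannianEDist (𝓡 5) (Ψ (x₀, lam0)) k <
      G.edist hG (Ψ (x₀, lam0)) k + ENNReal.ofReal δ :=
    ENNReal.lt_add_right hfin (ENNReal.ofReal_pos.2 hδ).ne'
  obtain ⟨γ, hγ0, hγ1, hγsm, hγlen, -⟩ :=
    Manifold.exists_lt_locally_constant_of_riemannianEDist_lt hlt zero_lt_one
  have hγ0U : γ 0 ∈ U := by rw [hγ0]; exact hyU
  -- the first time `τ` at which `γ` meets `K_s = Uᶜ`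
  set Sx : Set ℝ := Icc (0 : ℝ) 1 ∩ γ ⁻¹' Uᶜ with hSx
  have hSbdd : BddBelow Sx := ⟨0, fun ρ hρ ↦ hρ.1.1⟩
  set τ : ℝ := sInf Sx with hτdef
  have hτS : τ ∈ Sx :=
    (isClosed_Icc.inter (hUo.isClosed_compl.preimage hγsm.continuous)).csInf_mem
      ⟨1, ⟨zero_le_one, le_rfl⟩, by rw [mem_preimage, hγ1]; exact hk⟩ hSbdd
  have hτU : γ τ ∉ U := hτS.2
  have hτ0 : 0 < τ := hτS.1.1.lt_of_ne fun h ↦ hτU (h ▸ hγ0U)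
  have hτ1 : τ ≤ 1 := hτS.1.2
  have hbefore : ∀ ρ ∈ Ico (0 : ℝ) τ, γ ρ ∈ U := fun ρ hρ ↦ by
    by_contra hρU
    exact absurd hρ.2 (not_lt.2 (csInf_le hSbdd ⟨⟨hρ.1, hρ.2.le.trans hτ1⟩, hρU⟩))
  -- `γ τ` lies on the slice: `γ τ = Ψ (xτ, s)`
  have hmemcl : γ τ ∈ closure U := by
    have hmem : γ τ ∈ closure (γ '' Ico (0 : ℝ) τ) :=
      hγsm.continuous.continuousWithinAt.mem_closure_image
        (by rw [closure_Ico hτ0.ne]; exact right_mem_Icc.2 hτ0.le)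
    have hsub : γ '' Ico (0 : ℝ) τ ⊆ U := by
      rintro _ ⟨ρ, hρ, rfl⟩
      exact hbefore ρ hρ
    exact closure_mono hsub hmem
  -- by the closure clause `γ τ = Ψ q` with `q ∈ N × (0,1)`; in fact `q.2 ≤ s`: a limit of collar
  -- points of height `< s` is not shallower than `s` (compactness of `N × [t', s]`, and `hfar` to
  -- exclude limits of ever deeper points — the argument of stub P's `closure_image_far'`)
  obtain ⟨q, hqΩ, hqeq⟩ := hcl s hs1 hmemcl
  have hq2 : q.2 ≤ s := by
    by_contra hqt
    push Not at hqt
    obtain ⟨t', ht', hdeep⟩ := hfar (Ψ q) 1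
    have hsplit : U ⊆ Ψ '' (univ ×ˢ Ioo (0 : ℝ) t') ∪ Ψ '' (univ ×ˢ Icc t' s) := by
      rintro _ ⟨x, hx, rfl⟩
      rcases lt_or_ge x.2 t' with h | h
      · exact Or.inl ⟨x, ⟨mem_univ _, hx.2.1, h⟩, rfl⟩
      · exact Or.inr ⟨x, ⟨mem_univ _, h, hx.2.2.le⟩, rfl⟩
    have hp' := closure_mono hsplit hmemcl
    rw [closure_union] at hp'
    rcases hp' with h1 | h2
    · -- the distance-`1` ball about `Ψ q` misses the deep part
      have hball : {y : W | G.edist hG (Ψ q) y < 1} ∈ 𝓝 (Ψ q) :=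
        PseudoRiemannianMetric.setOf_edist_lt_mem_nhds hG (Ψ q) one_pos
      rw [← hqeq, mem_closure_iff_nhds] at h1
      obtain ⟨y, hyB, ⟨x, hx, rfl⟩⟩ := h1 _ hball
      have hlt : G.edist hG (Ψ q) (Ψ x) < 1 := hyB
      have hgt := hdeep x.1 x.2 hx.2
      simp only [ENNReal.coe_one, Prod.mk.eta] at hgt
      exact lt_irrefl _ (hgt.trans hlt)
    · -- a compact piece of bounded depth is closed
      have hKc : IsCompact (Ψ '' (univ ×ˢ Icc t' s)) := by
        refine (isCompact_univ.prod isCompact_Icc).image_of_continuousOn (hsm.continuousOn.mono ?_)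
        exact prod_mono Subset.rfl fun l hl ↦ ⟨ht'.1.trans_le hl.1, hl.2.trans_lt hs1.2⟩
      rw [hKc.isClosed.closure_eq, ← hqeq] at h2
      obtain ⟨x, hx, hxq⟩ := h2
      have hxΩ : x ∈ (univ ×ˢ Ioo (0 : ℝ) 1 : Set (N × ℝ)) :=
        ⟨mem_univ _, ht'.1.trans_le hx.2.1, hx.2.2.trans_lt hs1.2⟩
      have heq : x = q := hinj hxΩ hqΩ hxq
      have : x.2 ≤ s := hx.2.2
      rw [heq] at this
      exact lt_irrefl _ (hqt.trans_le this)
  obtain ⟨xτ, lτ⟩ := q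
  have hlτ : lτ = s := by
    rcases hq2.lt_or_eq with hlt' | heq
    · exact absurd ⟨(xτ, lτ), ⟨mem_univ _, hqΩ.2.1, hlt'⟩, hqeq⟩ hτU
    · exact heq
  have hpτeq : Ψ (xτ, s) = γ τ := by rw [← hlτ]; exact hqeq
  -- `γ` reaches `γ τ ∈ K_s` after length `≥ T`, so the rest of `γ` is shorter than `δ`
  have hTle : G.edist hG (Ψ (x₀, lam0)) k ≤ Manifold.pathELength (𝓡 5) γ 0 τ := by
    refine (hmin (γ τ) hτU).trans ?_
    have h := PseudoRiemannianMetric.edist_le_length hG hτ0.le (hγsm.contMDiffOn (s := Icc 0 τ))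
    rw [hγ0] at h
    exact h
  have hfoot : G.edist hG k (Ψ (xτ, s)) ≤ ENNReal.ofReal δ := by
    have hadd : Manifold.pathELength (𝓡 5) γ 0 τ + Manifold.pathELength (𝓡 5) γ τ 1 =
        Manifold.pathELength (𝓡 5) γ 0 1 := Manifold.pathELength_add hτ0.le hτ1
    have h2 : G.edist hG (Ψ (x₀, lam0)) k + Manifold.pathELength (𝓡 5) γ τ 1 <
        G.edist hG (Ψ (x₀, lam0)) k + ENNReal.ofReal δ :=
      calc G.edist hG (Ψ (x₀, lam0)) k + Manifold.pathELength (𝓡 5) γ τ 1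
          ≤ Manifold.pathELength (𝓡 5) γ 0 τ + Manifold.pathELength (𝓡 5) γ τ 1 :=
            add_le_add hTle le_rfl
        _ = Manifold.pathELength (𝓡 5) γ 0 1 := hadd
        _ < _ := hγlen
    have h3 : Manifold.pathELength (𝓡 5) γ τ 1 < ENNReal.ofReal δ :=
      (ENNReal.add_lt_add_iff_left hfin).1 h2
    have h4 := PseudoRiemannianMetric.edist_le_length hG hτ1 (hγsm.contMDiffOn (s := Icc τ 1))
    rw [hγ1] at h4
    rw [hpτeq, PseudoRiemannianMetric.edist_comm]
    exact h4.trans h3.le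
  -- every point of `γ([0,τ])` is a collar point of height in `(0,s]`
  have hIcc : ∀ ρ ∈ Icc (0 : ℝ) τ, ∃ p : N × ℝ, p.2 ∈ Ioc (0 : ℝ) s ∧ Ψ p = γ ρ := by
    intro ρ hρ
    rcases hρ.2.lt_or_eq with hlt' | heq
    · obtain ⟨p, hp, hpρ⟩ := hbefore ρ ⟨hρ.1, hlt'⟩
      exact ⟨p, ⟨hp.2.1, hp.2.2.le⟩, hpρ⟩
    · exact ⟨(xτ, s), ⟨hs.1, le_rfl⟩, by rw [heq]; exact hpτeq⟩
  -- the lift `β = Ψ⁻¹ ∘ γ` on `[0, τ]`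
  set Ω : Set (N × ℝ) := univ ×ˢ Ioo (0 : ℝ) 1 with hΩ
  set β : ℝ → N × ℝ := invFunOn Ψ Ω ∘ γ with hβdef
  have hβ : ∀ ρ ∈ Icc (0 : ℝ) τ, Ψ (β ρ) = γ ρ ∧ (β ρ).2 ∈ Ioc (0 : ℝ) s := by
    intro ρ hρ
    obtain ⟨p, hp2, hpρ⟩ := hIcc ρ hρ
    have hpΩ : p ∈ Ω := ⟨mem_univ _, hp2.1, hp2.2.trans_lt hs1.2⟩
    have hβρ : β ρ = p := by
      simp only [hβdef, comp_apply, ← hpρ]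
      exact hinj.leftInvOn_invFunOn hpΩ
    rw [hβρ]
    exact ⟨hpρ, hp2⟩
  have hβ0 : β 0 = (x₀, lam0) := by
    simp only [hβdef, comp_apply, hγ0]
    exact hinj.leftInvOn_invFunOn ⟨mem_univ _, hlam0.1, hlam0.2.trans hs1.2⟩
  have hβτ : β τ = (xτ, s) := by
    simp only [hβdef, comp_apply, ← hpτeq]
    exact hinj.leftInvOn_invFunOn ⟨mem_univ _, hs1⟩
  -- `β` is `C¹` on the open set `γ⁻¹(Ψ(N × (0,t₀))) ⊇ [0, τ]`
  set O : Set W := Ψ '' (univ ×ˢ Ioo (0 : ℝ) t₀) with hO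
  have hOo : IsOpen O := by
    rw [isOpen_iff_mem_nhds]
    rintro _ ⟨p, hp, rfl⟩
    exact (Sketch.collar_localInverse Ψ le_rfl ht₀.2 hsm hinj himm hp).1
  have hF : ContMDiffOn (𝓡 5) ((𝓡 4).prod 𝓘(ℝ, ℝ)) ∞ (invFunOn Ψ Ω) O := by
    rintro _ ⟨p, hp, rfl⟩
    exact (Sketch.collar_localInverse Ψ le_rfl ht₀.2 hsm hinj himm hp).2.contMDiffWithinAt
  have hVo : IsOpen (γ ⁻¹' O) := hOo.preimage hγsm.continuous
  have hIV : Icc (0 : ℝ) τ ⊆ γ ⁻¹' O := fun ρ hρ ↦ by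
    obtain ⟨p, hp2, hpρ⟩ := hIcc ρ hρ
    exact ⟨p, ⟨mem_univ _, hp2.1, hp2.2.trans_lt hs.2⟩, hpρ⟩
  have hβV : ContMDiffOn 𝓘(ℝ, ℝ) ((𝓡 4).prod 𝓘(ℝ, ℝ)) 1 β (γ ⁻¹' O) :=
    (hF.of_le (by exact_mod_cast le_top)).comp hγsm.contMDiffOn fun _ h ↦ h
  -- the length of the lifted segment
  have hL : G.length hG (Ψ ∘ β) 0 τ ≤
      ENNReal.ofReal ((G.edist hG (Ψ (x₀, lam0)) k).toReal + δ) := by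
    have h1 : G.length hG (Ψ ∘ β) 0 τ = Manifold.pathELength (𝓡 5) γ 0 τ :=
      Manifold.pathELength_congr fun ρ hρ ↦ (hβ ρ hρ).1
    rw [h1, ENNReal.ofReal_add ENNReal.toReal_nonneg hδ.le, ENNReal.ofReal_toReal hfin]
    exact (Manifold.pathELength_mono le_rfl hτ1).trans hγlen.le
  exact ⟨xτ, β, γ ⁻¹' O, τ, hfoot, hVo, hτ0.le, hIV, hβV, fun ρ hρ ↦ (hβ ρ hρ).2, hβ0, hβτ, hL⟩

end Summit.SmoothPoincare4.SmoothPoincare4.Cruxes.C0AhRecognition.CoreDistanceMorse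

end
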